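import Summits.HodgeConjecture.HodgeConjecture.Theorems.F0P3SpectralJunction          -- ★ J1′ generic unitary-datum `L²` junction (currency: `DiscreteAutomorphicRep`, `L2`, `IsDiscretelyDecomposable`)
import Literature.NumberTheory.Automorphic.AdelicUnitaryGroupSpectrum                 -- ★ `isDiscretelyDecomposable_rightRegular_adelicGroupData` (anisotropic `H`, [DeitmarEchterhoff2014, Thm. 9.2.2])
import Literature.NumberTheory.Automorphic.HilbertRepMultiplicityOneOfProjectionCriterion  -- ★ projection ∕ irreducible-closed-subspace toolkit (`le_of_starProjection_ne_zero_…`)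
import Summits.HodgeConjecture.HodgeConjecture.Theorems.K2E2L2OrthogonalReceiverOfNotMem   -- ★ socket closer landed: `l2OrthogonalReceiverOfNotMem` (RE-TIE BY IMPORT, ED. 2)
import Summits.HodgeConjecture.HodgeConjecture.Theorems.K2E2L2MemOfProjectionRigidity   -- ★ socket closer landed: `memOfProjectionRigidity` (RE-TIE BY IMPORT, ED. 2)
import HarnessLib

/-!
RE-TIE EDITION (2026-09-03T22:20Z): every landed socket of this module is now `:= @<landed decl>` BY IMPORT (statement bytes frozen); see the per-theorem comments.

# K2 ∕ E2 «ThetaExhaustionByRigidity» — tier-1 sockets, unit **L2-COMPLETENESS** (capture of an `L²`-class by projection rigidity)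

Track B «K2-LIT», engine E2, crux H413 (`stmt-HodgeConjecture-24833`), route `route-HodgeConjecture-HCCMUnconditional`.  Tier-0 line:
`Cruxes/H413/Lines/K2_E2_ThetaExhaustionByRigidity.lean` — these two sockets are the HILBERT-SPACE HALF of the tier-0 stub `stub_thetaClassCapture`
(`StubThetaClassCapture`): once every discrete `P′` receiving a non-zero projection of a class `θ ∈ L²([U(J)], μ)` equals `P`, the class lies in `P`.
Stated for the GENERIC unitary datum `UnitaryGroup.adelicGroupData F E c N J` with compact quotient and discretely decomposable `L²` (★ for anisotropic
hermitian `J`: `UnitaryGroup.isDiscretelyDecomposable_rightRegular_adelicGroupData`).  No theta series here.  No `def`∕`instance`∕`notation`; imports ★ only.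
CHAIN: `sig_K2E2L2OrthogonalReceiverOfNotMem` (M: orthogonal decomposition + an irreducible closed invariant subspace of `P^⊥` seen by `θ − pr_P θ`;
the closure of the image of an irreducible under the intertwiner `pr_{P^⊥}` is irreducible — polar decomposition ∕ ★ `HilbertRepMultiplicityOne…` toolkit)
→ `sig_K2E2L2MemOfProjectionRigidity` (S).
HONEST LABEL: HC_CM is proved only modulo the 7 printed citations (2 remaining named inputs: hLiu418 = stmt-HodgeConjecture-24832, h413 =
stmt-HodgeConjecture-24833) until rung 0 closes; nothing here changes any count.
-/

set_option Elab.async false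
set_option autoImplicit false
set_option linter.dupNamespace false

namespace Summit.HodgeConjecture.HodgeConjecture.Cruxes.H413.K2E2ThetaExhaustionByRigidity.L2Completeness

open scoped Matrix ComplexOrder ENNReal InnerProductSpace
open NumberField MeasureTheory
open Literature.NumberTheory Literature.NumberTheory.Automorphic Literature.NumberTheory.Automorphic.UnitaryGroup

/-- **sig L2-1 (size M) — a class outside `P` is seen by a discrete constituent ORTHOGONAL to `P`.**  Compact quotient, `L²(μ)` discretely decomposable
(`discretePart = ⊤`): if `θ ∉ P`, then `θ^⊥ := θ − pr_P θ ≠ 0` lies in the closed invariant `P^⊥`; by density of the irreducible closed invariant subspaces some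
irreducible `Q` pairs non-trivially with `θ^⊥`; the closure `Q′` of `pr_{P^⊥}(Q)` is a closed invariant subspace of `P^⊥`, irreducible (image of an
irreducible under a bounded intertwiner: partial-isometry ∕ polar decomposition, [Dixmier1977, §2]) and `pr_{Q′} θ = pr_{Q′} θ^⊥ ≠ 0`.  So there is a discrete
`P′` (namely `Q′`) with `P′ ⟂ P` and `pr_{P′} θ ≠ 0`.
[cite: DeitmarEchterhoff2014, Thm. 9.2.2] [cite: BorelJacquet1979, §4.6] [cite: Dixmier1977, §13.1]
size: M · deps: ★ `ContRepresentation.IsDiscretelyDecomposable`, ★ `HilbertRepMultiplicityOneOfProjectionCriterion` toolkit, Mathlib `Submodule.starProjection` ·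
unit: L2-COMPLETENESS · tier-2 target `Theorems/K2E2L2OrthogonalReceiverOfNotMem.lean` -/
theorem sig_K2E2L2OrthogonalReceiverOfNotMem :
    ∀ {F E : Type} [Field F] [NumberField F] [Field E] [NumberField E] [Algebra F E] {c : E ≃ₐ[F] E} {N : ℕ}
      {J : Matrix (Fin N) (Fin N) E} (μ : Measure (adelicGroupData F E c N J).automorphicQuotient)
      [(adelicGroupData F E c N J).IsAutomorphicMeasure μ] [CompactSpace (adelicGroupData F E c N J).automorphicQuotient],
      ((adelicGroupData F E c N J).rightRegular μ).IsDiscretelyDecomposable →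
      ∀ (P : DiscreteAutomorphicRep (adelicGroupData F E c N J) μ) (θ : (adelicGroupData F E c N J).L2 μ),
        θ ∉ P.space.toSubmodule →
        ∃ P' : DiscreteAutomorphicRep (adelicGroupData F E c N J) μ,
          P'.space.toSubmodule.IsOrtho P.space.toSubmodule ∧ P'.space.toSubmodule.starProjection θ ≠ 0 :=
  @Summit.HodgeConjecture.HodgeConjecture.Cruxes.H413.K2E2L2OrthogonalReceiverOfNotMem.l2OrthogonalReceiverOfNotMem  -- ★ RE-TIED BY IMPORT (statement bytes above FROZEN ∕ unchanged)

/-- **sig L2-2 (size S given L2-1) — CAPTURE BY PROJECTION RIGIDITY.**  Compact quotient, `L²(μ)` discretely decomposable: if every discrete `P′` with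
`pr_{P′} θ ≠ 0` equals `P`, then `θ ∈ P`.  PLAN: by contradiction from `sig_K2E2L2OrthogonalReceiverOfNotMem`: the orthogonal receiver `P′` equals `P`, so
`P ⟂ P`, so `P = 0`, contradicting `pr_{P′} θ ≠ 0`.  This is the abstract half of the tier-0 `stub_thetaClassCapture`; the other half (every receiver of the
pinned theta class is holomorphic-cotangent with finite component `ω_H(μ,a,χ)`) is `Capture.sig_K2E2CapHolThetaWitness`.
[cite: DeitmarEchterhoff2014, Thm. 9.2.2] [cite: BorelJacquet1979, §4.6] [cite: Liu2021, proof of Prop. 4.13 Case 1 (l. 2131–2137)]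
size: S · deps: L2-1 · unit: L2-COMPLETENESS · tier-2 target `Theorems/K2E2L2MemOfProjectionRigidity.lean` -/
theorem sig_K2E2L2MemOfProjectionRigidity :
    ∀ {F E : Type} [Field F] [NumberField F] [Field E] [NumberField E] [Algebra F E] {c : E ≃ₐ[F] E} {N : ℕ}
      {J : Matrix (Fin N) (Fin N) E} (μ : Measure (adelicGroupData F E c N J).automorphicQuotient)
      [(adelicGroupData F E c N J).IsAutomorphicMeasure μ] [CompactSpace (adelicGroupData F E c N J).automorphicQuotient],
      ((adelicGroupData F E c N J).rightRegular μ).IsDiscretelyDecomposable →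
      ∀ (P : DiscreteAutomorphicRep (adelicGroupData F E c N J) μ) (θ : (adelicGroupData F E c N J).L2 μ),
        (∀ P' : DiscreteAutomorphicRep (adelicGroupData F E c N J) μ, P'.space.toSubmodule.starProjection θ ≠ 0 → P' = P) →
        θ ∈ P.space.toSubmodule :=
  @Summit.HodgeConjecture.HodgeConjecture.Cruxes.H413.K2E2L2MemOfProjectionRigidity.memOfProjectionRigidity  -- ★ RE-TIED BY IMPORT (statement bytes above FROZEN ∕ unchanged)

end Summit.HodgeConjecture.HodgeConjecture.Cruxes.H413.K2E2ThetaExhaustionByRigidity.L2Completeness
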